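import Summits.Ventures.GridStability.Lyapunov.StructurePreservingPhase
import Literature.MathematicalPhysics.PowerSystems.LosslessMultimachineRegionOfAttraction
import HarnessLib

/-!
# GridStability/Lyapunov/StructurePreservingPolytope — the structure-preserving energy route on
# Vu–Turitsyn's POLYTOPE `{|σ_e + σ*_e| < π}` with the closed-form per-edge level
# `c < b_e · vtGap(σ*_e)` — part 1: the polytope, the edge bound, compactness on the momentum leaf

Cell `gridfusion` (LADDER-GRIDFUSION), seat gridfusion-lyap-1 (g6), lead RULING 6i (5) brief
«LFF-NU-SPARSE» as repaired on INBOX 2026-08-27T12:0xZ («SP-POLYTOPE»): the solver-free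
synchronisation-region theorem for the MIXED-ORDER lossless network class (model-2's
`StructurePreserving.Params`: generator nodes second order with `Mᵢ > 0`, load buses first order,
EVERY node damped `Dᵢ > 0` with an ARBITRARY damping pattern, ANY symmetric susceptive coupling graph
— sparse edge lists included; with `gen = univ` it is the network-reduced classical model with
non-uniform damping and no infinite bus) on the LARGE angle set of [cite: VuTuritsyn2016, §IV]
(«the polytope 𝒫 defined by |δ_kj + δ*_kj| < π») instead of the phase-cohesive window
`|δᵢ − δⱼ| < π/2` of the route of record `StructurePreservingRoa.sublevel_subset_regionOfAttraction`
(p475989, level `c⋆(θ, β) = (1 − sin θ)·β·(π/2 − θ)/4`). The Lyapunov function is UNCHANGED — the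
Bergen–Hill energy `V = ½ Σ_gen Mᵢωᵢ² + Σ_e b_e·U(σ_e, σ*_e)` [cite: Padiyar2013, §3.2 eq (3.11)],
«just one element of the large cone of all possible Lyapunov functions corresponding to
K_{kj} = B_kjV_kV_j» [cite: VuTuritsyn2016, §III] — and so is the dissipation identity
`V̇ = −Σᵢ Dᵢ δ̇ᵢ²` at every phase point (`StructurePreservingPhase.fderiv_phaseEnergy_phaseField`);
what changes is the GEOMETRY: the window and its quadratic comparison are replaced by

* `vtPolytope p δ₀` — `{(δ, ω) : |(δᵢ − δⱼ) + (δ₀ᵢ − δ₀ⱼ)| < π on coupled pairs}` (open;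
  `isOpen_vtPolytope`), i.e. every coupled line angle `σ` with `|σ + σ*| < π`;
* `mul_branchEnergy_le_potential` — on the CLOSED polytope every single edge term is below the
  potential, `b_ij·U(σ_ij, σ*_ij) ≤ W` (all edge terms are `≥ 0` there, model-2's
  `branchEnergy_nonneg`), and `lt_phaseEnergy_of_tight` — on a TIGHT edge (`|σ + σ*| = π`)
  `U ≥ vtGap(σ*) = 2 cos σ* − (π − 2|σ*|) sin|σ*|` (lit `vtGap_le_of_abs_eq`,
  [cite: VuTuritsyn2016, Appendix 9.3]), so `V > c` as soon as `c < b_e·vtGap(σ*_e)` on every coupled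
  edge — Vu–Turitsyn's «analytical approximation of V_min that does not require any optimizations»
  (third construction of §IV) for THIS energy function;
* `abs_sub_le_of_sublevel` / `isCompact_vtSublevel` — on the momentum leaf
  `{L(δ, ω) = L(δ₀, 0), ω = 0 off gen}` (`StructurePreservingPhase.constraintSet`, the device that
  removes the rotation without internodal coordinates) the piece `{x ∈ 𝒫 ∩ leaf : V x ≤ c}` is
  COMPACT for such `c`: closed because `V ≤ c` forbids tight edges (so `𝒫` may be replaced by its
  closure), bounded by the kinetic bound, `|φᵢ − φⱼ| ≤ 2π` per coupled edge (`φ = δ − δ₀`),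
  telescoping over the preconnected coupling graph (model-2's `abs_sub_le_card_mul`) and the
  D-weighted mean pinned by the momentum.

Part 2 `Lyapunov/StructurePreservingPolytopeUnique.lean`: uniqueness of the synchronous equilibrium
inside the polytope on its momentum leaf (pairing identity + STRICT sector bound on the polytope, «δ*
is the only stationary point inside 𝒫» [cite: VuTuritsyn2016, Appendix 9.2]) and hypothesis (iii) of
Barbashin–Krasovskii [cite: RoucheHabetsLaloy1977, Ch. II Thm 1.3]; part 3
`Lyapunov/StructurePreservingPolytopeRoa.lean`: the assembly (region of attraction, a priori over all
solutions; printed-vocabulary sentences). THREE COLUMNS: mathematics about the typed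
MODEL MV-3 (`plan/MODEL-VALIDITY.md`; with `gen = univ`: MV-2L without infinite bus); no certificate
data, no solver; no sentence here says that any grid is stable. One definition (`vtPolytope`, a set);
no named fact; standard axioms.
-/

noncomputable section

open Set Filter Topology Real Finset
open Summit.Ventures.GridStability.Models.StructurePreserving
open Summit.Ventures.GridStability.Models.StructurePreserving.Params
open Literature.MathematicalPhysics.PowerSystems.ClassicalModel.LosslessSystem (vtGap vtGap_le_of_abs_eq)

namespace Summit.Ventures.GridStability.Lyapunov.StructurePreserving

variable {n : ℕ}

/-! ### Vu–Turitsyn's polytope on the phase space -/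

/-- **Vu–Turitsyn's polytope** read on the phase space of the structure-preserving model: every
coupled line angle `σᵢⱼ = δᵢ − δⱼ` satisfies `|σᵢⱼ + σ*ᵢⱼ| < π` (`σ*ᵢⱼ = δ₀ᵢ − δ₀ⱼ`), i.e. lies in
`(−π − σ*, π − σ*)` — for `|σ*| < π/2` an interval of length `2π` containing `[−π/2, π/2]`.
[cite: VuTuritsyn2016, §IV (definition of 𝒫)] -/
def vtPolytope (p : Params n) (δ₀ : Fin n → ℝ) : Set ((Fin n → ℝ) × (Fin n → ℝ)) :=
  {x | ∀ i j, p.b i j ≠ 0 → |(x.1 i - x.1 j) + (δ₀ i - δ₀ j)| < π}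

/-- The polytope is open (a finite intersection of open slabs). [folklore] -/
theorem isOpen_vtPolytope (p : Params n) (δ₀ : Fin n → ℝ) : IsOpen (vtPolytope p δ₀) := by
  simp only [vtPolytope, setOf_forall]
  refine isOpen_iInter_of_finite fun i => isOpen_iInter_of_finite fun j =>
    isOpen_iInter_of_finite fun _ => ?_
  exact isOpen_lt (by fun_prop) continuous_const

/-- The equilibrium state lies in its polytope when the equilibrium line angles are below `π/2`.
[cite: VuTuritsyn2016, §IV] -/
theorem equilibrium_mem_vtPolytope (p : Params n) {δ₀ : Fin n → ℝ}
    (h0 : ∀ i j, p.b i j ≠ 0 → |δ₀ i - δ₀ j| < π / 2) :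
    ((δ₀, 0) : (Fin n → ℝ) × (Fin n → ℝ)) ∈ vtPolytope p δ₀ := by
  intro i j hij
  have h := abs_lt.1 (h0 i j hij)
  rw [abs_lt]
  constructor <;> linarith [h.1, h.2]

/-- The window of the route of record lies inside the polytope (`|σ| < π/2`, `|σ*| ≤ π/2` ⇒
`|σ + σ*| < π`): the polytope route never certifies LESS. [folklore] -/
theorem window_subset_vtPolytope (p : Params n) {δ₀ : Fin n → ℝ}
    (h0 : ∀ i j, p.b i j ≠ 0 → |δ₀ i - δ₀ j| ≤ π / 2) : window p ⊆ vtPolytope p δ₀ := by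
  intro x hx i j hij
  have h1 := abs_lt.1 (hx i j hij)
  have h2 := abs_le.1 (h0 i j hij)
  rw [abs_lt]
  constructor <;> linarith [h1.1, h1.2, h2.1, h2.2]

/-- Points of the closure of the polytope satisfy the closed constraints `|σ + σ*| ≤ π`.
[folklore] -/
theorem abs_le_of_mem_closure_vtPolytope (p : Params n) (δ₀ : Fin n → ℝ)
    {x : (Fin n → ℝ) × (Fin n → ℝ)} (hx : x ∈ closure (vtPolytope p δ₀)) :
    ∀ i j, p.b i j ≠ 0 → |(x.1 i - x.1 j) + (δ₀ i - δ₀ j)| ≤ π := by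
  have hclosed : IsClosed {x : (Fin n → ℝ) × (Fin n → ℝ) |
      ∀ i j, p.b i j ≠ 0 → |(x.1 i - x.1 j) + (δ₀ i - δ₀ j)| ≤ π} := by
    simp only [setOf_forall]
    refine isClosed_iInter fun i => isClosed_iInter fun j => isClosed_iInter fun _ => ?_
    exact isClosed_le (by fun_prop) continuous_const
  have hsub : vtPolytope p δ₀ ⊆ {x : (Fin n → ℝ) × (Fin n → ℝ) |
      ∀ i j, p.b i j ≠ 0 → |(x.1 i - x.1 j) + (δ₀ i - δ₀ j)| ≤ π} :=
    fun x hx i j hij => (hx i j hij).le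
  exact closure_minimal hsub hclosed hx

/-! ### The edge bound: one edge term is below the potential; a tight edge costs `b·vtGap` -/

/-- The branch energy is even in `(σ, σ*)` (a branch read in the opposite orientation).
[folklore] -/
theorem branchEnergy_neg_neg (σ σ₀ : ℝ) : branchEnergy (-σ) (-σ₀) = branchEnergy σ σ₀ := by
  unfold branchEnergy
  rw [Real.cos_neg, Real.cos_neg, Real.sin_neg]
  ring

/-- **On the closed polytope every single edge term is below the potential energy**:
`bᵢⱼ · U(σᵢⱼ, σ*ᵢⱼ) ≤ W(δ, δ₀)` (`bᵢⱼ = bⱼᵢ ≥ 0`, `|σ*| ≤ π/2` and `|σ + σ*| ≤ π` on coupled pairs,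
so that every edge term is nonnegative, model-2's `branchEnergy_nonneg`; the pair `(i, j)` and its
reverse contribute `½bᵢⱼU` each). [cite: VuTuritsyn2016, Appendix 9.3 («I_uv ≥ 0 ∀ x ∈ 𝒫»)] -/
theorem mul_branchEnergy_le_potential (p : Params n) (hb : ∀ i j, 0 ≤ p.b i j)
    (hsymm : ∀ i j, p.b i j = p.b j i) {δ₀ δ : Fin n → ℝ}
    (h0 : ∀ i j, p.b i j ≠ 0 → |δ₀ i - δ₀ j| ≤ π / 2)
    (hP : ∀ i j, p.b i j ≠ 0 → |(δ i - δ j) + (δ₀ i - δ₀ j)| ≤ π) (i j : Fin n) :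
    p.b i j * branchEnergy (δ i - δ j) (δ₀ i - δ₀ j) ≤ p.potential δ₀ δ := by
  set T : Fin n → Fin n → ℝ := fun a c => p.b a c * branchEnergy (δ a - δ c) (δ₀ a - δ₀ c) with hT
  have hTnn : ∀ a c, 0 ≤ T a c := by
    intro a c
    by_cases hac : p.b a c = 0
    · simp [hT, hac]
    · exact mul_nonneg (hb a c) (branchEnergy_nonneg (h0 a c hac) (hP a c hac))
  have hpot : p.potential δ₀ δ = (1 / 2) * ∑ a, ∑ c, T a c := rfl
  by_cases hij : i = j
  · subst hij
    have : branchEnergy (δ i - δ i) (δ₀ i - δ₀ i) = 0 := by simp [branchEnergy]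
    rw [this, mul_zero, hpot]
    exact mul_nonneg (by norm_num) (Finset.sum_nonneg fun a _ => Finset.sum_nonneg fun c _ => hTnn a c)
  · -- the two orientations of the edge are two entries of the nonnegative family `T`
    have hsym : T j i = T i j := by
      simp only [hT]
      rw [hsymm j i, show δ j - δ i = -(δ i - δ j) by ring,
        show δ₀ j - δ₀ i = -(δ₀ i - δ₀ j) by ring, branchEnergy_neg_neg]
    have hrow : ∀ a c, T a c ≤ ∑ c', T a c' := fun a c =>
      Finset.single_le_sum (f := fun c' => T a c') (fun c' _ => hTnn a c') (Finset.mem_univ c)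
    have hrows : (∑ c', T i c') + ∑ c', T j c' ≤ ∑ a, ∑ c', T a c' := by
      rw [← Finset.sum_pair (f := fun a => ∑ c', T a c') hij]
      exact Finset.sum_le_sum_of_subset_of_nonneg (Finset.subset_univ _)
        fun a _ _ => Finset.sum_nonneg fun c' _ => hTnn a c'
    have h2 : T i j + T j i ≤ ∑ a, ∑ c', T a c' := (add_le_add (hrow i j) (hrow j i)).trans hrows
    rw [hsym] at h2
    show T i j ≤ p.potential δ₀ δ
    rw [hpot]
    linarith

/-- **A tight edge costs at least `b·vtGap(σ*)`.** On the closed polytope (all `Dᵢ`, `Mᵢ` patterns;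
`bᵢⱼ = bⱼᵢ ≥ 0`, `|σ*| ≤ π/2` on coupled pairs), if some coupled pair is TIGHT —
`|σᵢⱼ + σ*ᵢⱼ| = π` — then `V(δ, ω) ≥ bᵢⱼ·vtGap(σ*ᵢⱼ)`; hence `V > c` for every `c` below the
per-edge closed-form level `b_e·vtGap(σ*_e)`. This is Vu–Turitsyn's «analytical approximation of
V_min» (third construction) for the energy function (`K = W`, no quadratic term `q_e`).
[cite: VuTuritsyn2016, §IV (third construction) and Appendix 9.3] -/
theorem lt_phaseEnergy_of_tight {p : Params n} (hp : p.WellFormed) (hb : ∀ i j, 0 ≤ p.b i j)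
    {δ₀ : Fin n → ℝ} (h0 : ∀ i j, p.b i j ≠ 0 → |δ₀ i - δ₀ j| ≤ π / 2) {c : ℝ}
    (hc : ∀ i j, p.b i j ≠ 0 → c < p.b i j * vtGap (δ₀ i - δ₀ j))
    {x : (Fin n → ℝ) × (Fin n → ℝ)}
    (hP : ∀ i j, p.b i j ≠ 0 → |(x.1 i - x.1 j) + (δ₀ i - δ₀ j)| ≤ π)
    {i j : Fin n} (hij : p.b i j ≠ 0) (htight : |(x.1 i - x.1 j) + (δ₀ i - δ₀ j)| = π) :
    c < phaseEnergy p δ₀ x := by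
  have hgap : vtGap (δ₀ i - δ₀ j) ≤ branchEnergy (x.1 i - x.1 j) (δ₀ i - δ₀ j) := by
    have h := vtGap_le_of_abs_eq (h0 i j hij) htight
    have hid : branchEnergy (x.1 i - x.1 j) (δ₀ i - δ₀ j)
        = (Real.cos (δ₀ i - δ₀ j) + (δ₀ i - δ₀ j) * Real.sin (δ₀ i - δ₀ j))
          - (Real.cos (x.1 i - x.1 j) + (x.1 i - x.1 j) * Real.sin (δ₀ i - δ₀ j)) := by
      unfold branchEnergy; ring
    rwa [← hid] at h
  have h1 : p.b i j * vtGap (δ₀ i - δ₀ j) ≤ p.b i j * branchEnergy (x.1 i - x.1 j) (δ₀ i - δ₀ j) :=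
    mul_le_mul_of_nonneg_left hgap (hb i j)
  have h2 := mul_branchEnergy_le_potential p hb hp.b_symm h0 hP i j
  have hK : 0 ≤ p.kinetic x.2 := p.kinetic_nonneg (fun k hk => (hp.M_pos k hk).le) x.2
  have hV : phaseEnergy p δ₀ x = p.kinetic x.2 + p.potential δ₀ x.1 := rfl
  rw [hV]
  linarith [hc i j hij]

/-- Below the per-edge level, `V ≤ c` on the closed polytope forces the OPEN polytope (no edge is
tight). [cite: VuTuritsyn2016, §IV (the set ℛ = {x ∈ 𝒫 : V(x) < V_min})] -/
theorem mem_vtPolytope_of_phaseEnergy_le {p : Params n} (hp : p.WellFormed)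
    (hb : ∀ i j, 0 ≤ p.b i j) {δ₀ : Fin n → ℝ} (h0 : ∀ i j, p.b i j ≠ 0 → |δ₀ i - δ₀ j| ≤ π / 2)
    {c : ℝ} (hc : ∀ i j, p.b i j ≠ 0 → c < p.b i j * vtGap (δ₀ i - δ₀ j))
    {x : (Fin n → ℝ) × (Fin n → ℝ)}
    (hP : ∀ i j, p.b i j ≠ 0 → |(x.1 i - x.1 j) + (δ₀ i - δ₀ j)| ≤ π)
    (hV : phaseEnergy p δ₀ x ≤ c) : x ∈ vtPolytope p δ₀ := by
  intro i j hij
  rcases (hP i j hij).lt_or_eq with h | h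
  · exact h
  · exact absurd hV (not_le.2 (lt_phaseEnergy_of_tight hp hb h0 hc hP hij h))

/-! ### Boundedness and compactness of the sublevel piece on the momentum leaf -/

/-- **State bound on the closed polytope and the momentum leaf.** Well-formed data, susceptive
couplings, a preconnected coupling graph, `n ≠ 0`, `|σ*| ≤ π/2` on coupled pairs; for a phase point
with closed-polytope angles, `L(δ, ω) = L(δ₀, 0)` and `V ≤ c`: every generator frequency has
`|ωᵢ| ≤ √(2c/Mᵢ)` and every bus angle has
`|δᵢ − δ₀ᵢ| ≤ (Σ_gen Mⱼ√(2c/Mⱼ))/ΣⱼDⱼ + 2πn` (kinetic bound — the potential is `≥ 0` on the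
closed polytope —, `|φᵢ − φⱼ| ≤ 2π` per coupled edge, telescoping, D-weighted mean pinned by `L`).
[folklore] -/
theorem abs_sub_le_of_sublevel {p : Params n} (hp : p.WellFormed) (hn : n ≠ 0)
    (hconn : p.couplingGraph.Preconnected) (hb : ∀ i j, 0 ≤ p.b i j)
    {δ₀ : Fin n → ℝ} (h0 : ∀ i j, p.b i j ≠ 0 → |δ₀ i - δ₀ j| ≤ π / 2)
    {x : (Fin n → ℝ) × (Fin n → ℝ)}
    (hP : ∀ i j, p.b i j ≠ 0 → |(x.1 i - x.1 j) + (δ₀ i - δ₀ j)| ≤ π) {c : ℝ}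
    (hV : phaseEnergy p δ₀ x ≤ c) (hL : p.momentum x.1 x.2 = p.momentum δ₀ 0) :
    (∀ i ∈ p.gen, |x.2 i| ≤ Real.sqrt (2 * c / p.M i)) ∧
    ∀ i, |x.1 i - δ₀ i| ≤ (∑ j ∈ p.gen, p.M j * Real.sqrt (2 * c / p.M j)) / (∑ j, p.D j)
        + 2 * π * n := by
  have hW0 : 0 ≤ p.potential δ₀ x.1 := p.potential_nonneg hb h0 hP
  have hKc : p.kinetic x.2 ≤ c := by
    have : phaseEnergy p δ₀ x = p.kinetic x.2 + p.potential δ₀ x.1 := rfl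
    linarith
  -- (1) generator frequencies
  have hω : ∀ i ∈ p.gen, |x.2 i| ≤ Real.sqrt (2 * c / p.M i) := by
    intro i hi
    have hMi := hp.M_pos i hi
    have h1 := p.half_M_mul_sq_le_kinetic (fun j hj => (hp.M_pos j hj).le) x.2 hi
    refine Real.abs_le_sqrt ?_
    rw [le_div_iff₀ hMi]
    nlinarith
  refine ⟨hω, fun i => ?_⟩
  -- (2) branch deviations are at most `2π` per coupled edge, `2πn` between any two buses
  set φ : Fin n → ℝ := fun k => x.1 k - δ₀ k with hφ
  have hedge : ∀ u v, p.couplingGraph.Adj u v → |φ u - φ v| ≤ 2 * π := by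
    intro u v huv
    have hbuv : p.b u v ≠ 0 := ((p.couplingGraph_adj_of_symm hp.b_symm u v).1 huv).2
    have h1 := abs_le.1 (hP u v hbuv)
    have h2 := abs_le.1 (h0 u v hbuv)
    have hid : φ u - φ v = ((x.1 u - x.1 v) + (δ₀ u - δ₀ v)) - 2 * (δ₀ u - δ₀ v) := by
      simp only [hφ]; ring
    rw [hid, abs_le]
    constructor <;> linarith [h1.1, h1.2, h2.1, h2.2]
  have h2π : 0 ≤ 2 * π := by linarith [Real.pi_pos]
  have hpair : ∀ j, |φ i - φ j| ≤ n * (2 * π) := fun j => p.abs_sub_le_card_mul hconn h2π hedge i j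
  -- (3) the momentum constraint pins the D-weighted mean of φ
  have hDsum := sum_D_pos hp hn
  have hmom : ∑ j, p.D j * φ j = -∑ j ∈ p.gen, p.M j * x.2 j := by
    have : p.momentum x.1 x.2 - p.momentum δ₀ 0 = 0 := sub_eq_zero.mpr hL
    unfold Params.momentum at this
    simp only [Pi.zero_apply, mul_zero, Finset.sum_const_zero, zero_add] at this
    have hsplit : ∑ j, p.D j * x.1 j - ∑ j, p.D j * δ₀ j = ∑ j, p.D j * φ j := by
      rw [← Finset.sum_sub_distrib]
      exact Finset.sum_congr rfl fun j _ => by simp only [hφ]; ring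
    linarith
  have hmeanbd : |∑ j, p.D j * φ j| ≤ ∑ j ∈ p.gen, p.M j * Real.sqrt (2 * c / p.M j) := by
    rw [hmom, abs_neg]
    refine (Finset.abs_sum_le_sum_abs _ _).trans (Finset.sum_le_sum fun j hj => ?_)
    rw [abs_mul, abs_of_pos (hp.M_pos j hj)]
    exact mul_le_mul_of_nonneg_left (hω j hj) (hp.M_pos j hj).le
  have hdecomp : (∑ j, p.D j) * φ i = ∑ j, p.D j * φ j + ∑ j, p.D j * (φ i - φ j) := by
    rw [Finset.sum_mul, ← Finset.sum_add_distrib]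
    exact Finset.sum_congr rfl fun j _ => by ring
  have hdev : |∑ j, p.D j * (φ i - φ j)| ≤ (∑ j, p.D j) * (n * (2 * π)) := by
    refine (Finset.abs_sum_le_sum_abs _ _).trans ?_
    rw [Finset.sum_mul]
    refine Finset.sum_le_sum fun j _ => ?_
    rw [abs_mul, abs_of_pos (hp.D_pos j)]
    exact mul_le_mul_of_nonneg_left (hpair j) (hp.D_pos j).le
  have habs : (∑ j, p.D j) * |φ i|
      ≤ ∑ j ∈ p.gen, p.M j * Real.sqrt (2 * c / p.M j) + (∑ j, p.D j) * (n * (2 * π)) := by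
    rw [← abs_of_pos hDsum, ← abs_mul, abs_of_pos hDsum, hdecomp]
    exact (abs_add_le _ _).trans (add_le_add hmeanbd hdev)
  have : |φ i| ≤ (∑ j ∈ p.gen, p.M j * Real.sqrt (2 * c / p.M j)) / (∑ j, p.D j)
      + 2 * π * n := by
    rw [div_add' _ _ _ hDsum.ne', le_div_iff₀ hDsum]
    nlinarith
  simpa only [hφ] using this

/-- **Compactness of the sublevel piece on the momentum leaf.** For well-formed susceptive data on a
preconnected coupling graph (`n ≠ 0`), equilibrium line angles `|σ*| ≤ π/2` on coupled pairs and a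
level `c < b_e·vtGap(σ*_e)` on every coupled pair, the piece
`S = {x ∈ vtPolytope ∩ constraintSet | V x ≤ c}` is compact: it is CLOSED because below the level no
edge is tight (`mem_vtPolytope_of_phaseEnergy_le`: the open polytope may be replaced by its closure)
and BOUNDED by `abs_sub_le_of_sublevel`. [folklore] -/
theorem isCompact_vtSublevel {p : Params n} (hp : p.WellFormed) (hn : n ≠ 0)
    (hconn : p.couplingGraph.Preconnected) (hb : ∀ i j, 0 ≤ p.b i j)
    {δ₀ : Fin n → ℝ} (h0 : ∀ i j, p.b i j ≠ 0 → |δ₀ i - δ₀ j| ≤ π / 2) {c : ℝ}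
    (hc : ∀ i j, p.b i j ≠ 0 → c < p.b i j * vtGap (δ₀ i - δ₀ j)) :
    IsCompact {x | x ∈ vtPolytope p δ₀ ∩ constraintSet p δ₀ ∧ phaseEnergy p δ₀ x ≤ c} := by
  -- the same set with the CLOSED polytope
  set S' : Set ((Fin n → ℝ) × (Fin n → ℝ)) :=
    {x | (∀ i j, p.b i j ≠ 0 → |(x.1 i - x.1 j) + (δ₀ i - δ₀ j)| ≤ π) ∧ x ∈ constraintSet p δ₀
      ∧ phaseEnergy p δ₀ x ≤ c} with hS'
  have hSS' : {x | x ∈ vtPolytope p δ₀ ∩ constraintSet p δ₀ ∧ phaseEnergy p δ₀ x ≤ c} = S' := by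
    ext x
    simp only [hS', mem_setOf_eq, mem_inter_iff]
    constructor
    · rintro ⟨⟨hw, hM⟩, hV⟩
      exact ⟨fun i j hij => (hw i j hij).le, hM, hV⟩
    · rintro ⟨hw, hM, hV⟩
      exact ⟨⟨mem_vtPolytope_of_phaseEnergy_le hp hb h0 hc hw hV, hM⟩, hV⟩
  rw [hSS']
  refine Metric.isCompact_of_isClosed_isBounded ?_ ?_
  · -- closed
    have h1 : IsClosed {x : (Fin n → ℝ) × (Fin n → ℝ) |
        ∀ i j, p.b i j ≠ 0 → |(x.1 i - x.1 j) + (δ₀ i - δ₀ j)| ≤ π} := by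
      simp only [setOf_forall]
      refine isClosed_iInter fun i => isClosed_iInter fun j => isClosed_iInter fun _ => ?_
      exact isClosed_le (by fun_prop) continuous_const
    have h3 : IsClosed {x : (Fin n → ℝ) × (Fin n → ℝ) | phaseEnergy p δ₀ x ≤ c} :=
      isClosed_le (contDiff_phaseEnergy p δ₀).continuous continuous_const
    have h := h1.inter ((isClosed_constraintSet p δ₀).inter h3)
    simpa only [hS', setOf_and, setOf_mem_eq] using h
  · -- bounded
    rw [isBounded_iff_forall_norm_le]
    set R : ℝ := (∑ j ∈ p.gen, p.M j * Real.sqrt (2 * c / p.M j)) / (∑ j, p.D j)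
      + 2 * π * n with hR
    set B : ℝ := ∑ j ∈ p.gen, Real.sqrt (2 * c / p.M j) with hB
    refine ⟨R + ‖δ₀‖ + B, fun x hx => ?_⟩
    obtain ⟨hw, ⟨hL, hω0⟩, hV⟩ := hx
    have hst := abs_sub_le_of_sublevel hp hn hconn hb h0 hw hV hL
    have hBnn : 0 ≤ B := Finset.sum_nonneg fun j _ => Real.sqrt_nonneg _
    have hδ : ∀ i, |x.1 i| ≤ R + ‖δ₀‖ := fun i => by
      have h1 : |x.1 i - δ₀ i| ≤ R := by simpa only [hR] using hst.2 i
      have h2 : |δ₀ i| ≤ ‖δ₀‖ := by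
        have := norm_le_pi_norm δ₀ i
        simpa only [Real.norm_eq_abs] using this
      calc |x.1 i| = |(x.1 i - δ₀ i) + δ₀ i| := by ring_nf
        _ ≤ |x.1 i - δ₀ i| + |δ₀ i| := abs_add_le _ _
        _ ≤ R + ‖δ₀‖ := add_le_add h1 h2
    have hRnn : 0 ≤ R + ‖δ₀‖ := by
      obtain ⟨k, hk⟩ := Nat.exists_eq_succ_of_ne_zero hn
      subst hk
      exact (abs_nonneg _).trans (hδ 0)
    have hω : ∀ i, |x.2 i| ≤ B := fun i => by
      by_cases hi : i ∈ p.gen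
      · exact (hst.1 i hi).trans (Finset.single_le_sum (f := fun j => Real.sqrt (2 * c / p.M j))
          (fun j _ => Real.sqrt_nonneg _) hi)
      · rw [hω0 i hi, abs_zero]
        exact hBnn
    have hn1 : ‖x.1‖ ≤ R + ‖δ₀‖ + B := by
      refine (pi_norm_le_iff_of_nonneg (add_nonneg hRnn hBnn)).2 fun i => ?_
      rw [Real.norm_eq_abs]
      exact (hδ i).trans (le_add_of_nonneg_right hBnn)
    have hn2 : ‖x.2‖ ≤ R + ‖δ₀‖ + B := by
      refine (pi_norm_le_iff_of_nonneg (add_nonneg hRnn hBnn)).2 fun i => ?_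
      rw [Real.norm_eq_abs]
      exact (hω i).trans (le_add_of_nonneg_left hRnn)
    rw [Prod.norm_def]
    exact max_le hn1 hn2

end Summit.Ventures.GridStability.Lyapunov.StructurePreserving

end
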